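import Mathlib.Algebra.Homology.DerivedCategory.Ext.MapBijective
import HarnessLib

/-!
# Venture HSemireg — the equivariant / twisted `Ext` EMBEDS in the `Ext` of the cover when the unit of the
# forgetful functor is split (PLAN-W1-TW item T-8 (b), injectivity half; w1-tw-2)

HONEST FRAMING. Pure homological algebra with Mathlib's `Abelian.Ext` and `Ext.mapExactFunctor`; no gerbe,
no group action, no variety is constructed. The geometric reading (twisted sheaves on `(A₀, α)` = free
Heisenberg-symmetric honest sheaves on an isogenous cover, cell files `widen/W1/TW-EQ-w1tw1.md` §2 and
`widen/W1/W1-TW2-FOUNDATIONS.md` §3) enters only through the HYPOTHESES of the theorems below. Nothing here says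
HC, HC_CM or HC_AV is proved.

## The step being served (th-4 g6's answer to (Q2), bus 2026-08-22T22:37:17Z, recorded as T-8)

For a finite group `N` acting freely by translations on an abelian variety `A″` with quotient `q : A″ → A₀` and
`|N|` invertible, the `Ext` groups of the `N`-equivariant (equivalently: `α`-twisted) category are the
`N`-INVARIANTS of the `Ext` groups on `A″`: `Ext_α(E,E) = Ext_{A″}(q^*E, q^*E)^N`. th-4 split this into (a) a
descent equivalence and (b) «`Ext` in the equivariant category `=` invariants of `Ext` downstairs, for `|N|`
invertible», neither typed. This file types the INJECTIVITY HALF of (b) in the carrier-free form it really has: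

* Setting: `U : C ⥤ D` exact additive (the forgetful functor), `R : D ⥤ C` exact additive (co-induction),
  `η_Y : Y ⟶ R (U Y)` ANY natural family (the unit; naturality `hη` as a hypothesis), and at the object `Y` a RETRACTION
  `r : R (U Y) ⟶ Y`, `η_Y ≫ r = 𝟙` (the averaging map `(1/|N|) Σ_g φ_g⁻¹ ∘ pr_g`, which is where `|N|` invertible
  enters). `C` has enough injectives.
* `comp_mk₀_eq_mk₀_comp_mapExactFunctor` — **the round trip is natural on `Ext`:**
  `x ≫ η_Y = η_X ≫ R(U(x))` in `Extⁿ(X, R U Y)` for every `x ∈ Extⁿ_C(X, Y)` (dimension shifting along an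
  injective presentation of `Y`, Mathlib's `ShortExact.extClass_naturality` and `Ext.mapExactFunctor_extClass`;
  the same skeleton as th-4's `mapExactFunctor_comp_mk₀_eq`, here with the identity functor on the left, so that no
  `mapExactFunctor (𝟭 C)` bookkeeping is needed).
* `eq_comp_of_retraction` — `x = (η_X ≫ R(U(x))) ≫ r` : every class is recovered from its image downstairs.
* `mapExtAddHom_injective_of_retraction` (+ `…_of_adjunction_of_retraction` for the unit of an adjunction `U ⊣ R`)
  — **`Extⁿ_C(X, Y) → Extⁿ_D(U X, U Y)` is INJECTIVE** for all `X`, `n`.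
  (Without the retraction this is false even for faithful exact `U` preserving injectives: `H¹(G, k) ≠ 0` maps
  to `Ext¹_k(k, k) = 0` when `char k ∣ |G|`.)

So for the cell: `dim Ext²_α(E, E) ≤ dim Ext²_{A″}(F″, F″)`, and a kernel vector of `σ_E` is a kernel vector of
`σ_{F″}` (with `σ_E = σ_{F″} ∘ U` on `Ext²`, TW-EQ (A1)(iii)) — the half of the «invariant-part law» that the
linear-algebra file `EquivariantSigmaInvariants.lean` (w1-tw-1, p342955) takes as its input `V^G ⊆ V`. The IMAGE
statement (`= N`-invariants) needs the Mackey decomposition `U R ≅ ⊕_g g^*` and is NOT typed here.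

## References

* R.-O. Buchweitz, H. Flenner, *A semiregularity map for modules and applications to deformations*,
  Compositio Math. 137 (2003), §5 (the deformation-theoretic use of `Ext²`). [BuchweitzFlenner2003]
* J. P. Pridham, *Semiregularity as a consequence of Goodwillie's theorem*, Forum Math. Sigma 12 (2024) e126,
  Rem. 2.26 (μ_r-gerbes / twisted perfect complexes). [Pridham2024]
-/

noncomputable section

open CategoryTheory CategoryTheory.Abelian CategoryTheory.Limits

namespace Summit.Ventures.HSemireg.EquivariantExt

universe w w' v v' u u'

variable {C : Type u} [Category.{v} C] [Abelian C] {D : Type u'} [Category.{v'} D] [Abelian D]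
  (U : C ⥤ D) (R : D ⥤ C) [U.Additive] [R.Additive]
  [PreservesFiniteLimits U] [PreservesFiniteColimits U] [PreservesFiniteLimits R] [PreservesFiniteColimits R]
  [HasExt.{w} C] [HasExt.{w'} D] [EnoughInjectives C]
  (η : ∀ Y : C, Y ⟶ R.obj (U.obj Y))
  (hη : ∀ ⦃Y Y' : C⦄ (f : Y ⟶ Y'), f ≫ η Y' = η Y ≫ R.map (U.map f))

include hη in
/-- **The round trip `R ∘ U` is natural on `Ext` along its unit.** For exact additive functors `U : C ⥤ D`,
`R : D ⥤ C`, a natural transformation `η : 𝟭 ⟶ U ⋙ R` and `x ∈ Extⁿ_C(X, Y)` (`C` with enough injectives):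
`x ≫ η_Y = η_X ≫ R(U(x))` in `Extⁿ(X, R(U Y))`. Degree `0` is the naturality square of `η`; a class of degree
`n + 1` is `x₃ ≫ δ` for the connecting class `δ` of an injective presentation `0 → Y → I → Q → 0`, and `δ` is natural
along the morphism of short exact sequences `η : S → R(U(S))` (`ShortExact.extClass_naturality`,
`Ext.mapExactFunctor_extClass`). [folklore] -/
theorem comp_mk₀_eq_mk₀_comp_mapExactFunctor {X Y : C} {n : ℕ} (x : Ext X Y n) :
    x.comp (Ext.mk₀ (η Y)) (add_zero n) =
      (Ext.mk₀ (η X)).comp ((x.mapExactFunctor U).mapExactFunctor R) (zero_add n) := by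
  induction n generalizing Y with
  | zero =>
    obtain ⟨f, rfl⟩ := (Ext.mk₀_bijective X Y).2 x
    rw [Ext.mapExactFunctor_mk₀, Ext.mapExactFunctor_mk₀, Ext.mk₀_comp_mk₀, Ext.mk₀_comp_mk₀, hη]
  | succ n ih =>
    let I : InjectivePresentation Y := (EnoughInjectives.presentation Y).some
    let S : ShortComplex C := ShortComplex.mk _ _ (cokernel.condition I.f)
    have hS : S.ShortExact := { exact := ShortComplex.exact_cokernel I.f }
    haveI : Injective S.X₂ := I.injective
    obtain ⟨x₃, rfl⟩ : ∃ x₃ : Ext X S.X₃ n, x₃.comp hS.extClass rfl = x :=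
      Ext.covariant_sequence_exact₁ X hS x (Ext.eq_zero_of_injective _) rfl
    -- `η` on the three terms is a morphism of short exact sequences `S → R(U(S))`
    let τ : S ⟶ (S.map U).map R :=
      { τ₁ := η S.X₁, τ₂ := η S.X₂, τ₃ := η S.X₃, comm₁₂ := (hη S.f).symm, comm₂₃ := (hη S.g).symm }
    have hτ := hS.extClass_naturality ((hS.map_of_exact U).map_of_exact R) τ
    have e2 : ((hS.extClass).mapExactFunctor U).mapExactFunctor R = ((hS.map_of_exact U).map_of_exact R).extClass :=
      (congrArg (Ext.mapExactFunctor R) (Ext.mapExactFunctor_extClass U hS)).trans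
        (Ext.mapExactFunctor_extClass R (hS.map_of_exact U))
    have hnat : (hS.extClass).comp (Ext.mk₀ (η Y)) (add_zero 1) =
        (Ext.mk₀ (η S.X₃)).comp (((hS.extClass).mapExactFunctor U).mapExactFunctor R) (zero_add 1) :=
      hτ.trans (congrArg (fun a => (Ext.mk₀ (η S.X₃)).comp a (zero_add 1)) e2).symm
    rw [Ext.mapExactFunctor_comp, Ext.mapExactFunctor_comp, Ext.comp_assoc_of_third_deg_zero, hnat,
      ← Ext.comp_assoc_of_second_deg_zero, ih x₃]
    exact Ext.comp_assoc _ _ _ (zero_add n) rfl (by omega)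

include hη in
/-- **Recovery formula.** With a retraction `r` of the unit at `Y` (`η_Y ≫ r = 𝟙 Y`), every class
`x ∈ Extⁿ_C(X, Y)` is `(η_X ≫ R(U(x))) ≫ r`. [folklore] -/
theorem eq_comp_of_retraction {X Y : C} (r : R.obj (U.obj Y) ⟶ Y) (hr : η Y ≫ r = 𝟙 Y) {n : ℕ}
    (x : Ext X Y n) :
    x = ((Ext.mk₀ (η X)).comp ((x.mapExactFunctor U).mapExactFunctor R) (zero_add n)).comp
      (Ext.mk₀ r) (add_zero n) := by
  rw [← comp_mk₀_eq_mk₀_comp_mapExactFunctor U R η hη x, Ext.comp_assoc_of_third_deg_zero,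
    Ext.mk₀_comp_mk₀, hr, Ext.comp_mk₀_id]

include hη in
/-- **`Ext` along the forgetful functor is injective when the unit splits** (T-8 (b), injectivity half).
`U : C ⥤ D`, `R : D ⥤ C` exact additive, `η : 𝟭 ⟶ U ⋙ R` with a retraction at `Y`; then
`Extⁿ_C(X, Y) → Extⁿ_D(U X, U Y)` (Mathlib `Functor.mapExtAddHom`) is injective for every `X` and `n`. In the cell's
reading: `C` = `N`-equivariant (≃ `α`-twisted) sheaves, `D` = sheaves on the cover `A″`, `U` forgetful, `R` =
co-induction `⊕_g g^*`, `r` = averaging (`|N|` invertible): `Ext_α(E, E) ↪ Ext_{A″}(F″, F″)`.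
[cite: BuchweitzFlenner2003, §5; Pridham2024, Rem. 2.26] -/
theorem mapExtAddHom_injective_of_retraction {Y : C} (r : R.obj (U.obj Y) ⟶ Y) (hr : η Y ≫ r = 𝟙 Y)
    (X : C) (n : ℕ) :
    Function.Injective (U.mapExtAddHom X Y n) := by
  intro x₁ x₂ h
  simp only [Functor.mapExtAddHom_apply] at h
  rw [eq_comp_of_retraction U R η hη r hr x₁, eq_comp_of_retraction U R η hη r hr x₂, h]

/-- The same packaged with Mathlib's natural transformations: the UNIT `adj.unit : 𝟭 ⟶ U ⋙ R` of an adjunction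
`U ⊣ R` between exact additive functors, split at `Y` by `r`, gives injectivity of
`Extⁿ_C(X, Y) → Extⁿ_D(U X, U Y)` for every `X`, `n`. [folklore] -/
theorem mapExtAddHom_injective_of_adjunction_of_retraction (adj : U ⊣ R) {Y : C} (r : R.obj (U.obj Y) ⟶ Y)
    (hr : adj.unit.app Y ≫ r = 𝟙 Y) (X : C) (n : ℕ) :
    Function.Injective (U.mapExtAddHom X Y n) :=
  mapExtAddHom_injective_of_retraction U R (fun Z => adj.unit.app Z) (fun _ _ f => adj.unit.naturality f) r hr X n

end Summit.Ventures.HSemireg.EquivariantExt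

end

/-! ## Appendix (2026-08-23): the IMAGE of `· ≫ η_Y` is the fixed part of the idempotent `p = r ≫ η_Y`

w1-tw-1's remark (bus 2026-08-22T23:46:33Z): with a retraction `r` of `η_Y`, `p := r ≫ η_Y` is an idempotent
endomorphism of `R(U Y)`, and for every `X`, `n` the image of `Extⁿ(X, Y) → Extⁿ(X, R(U Y))`, `x ↦ x ≫ η_Y`, is EXACTLY
the fixed set of `p_* = (· ≫ p)`. This closes the «image» half of T-8 (b) ABSTRACTLY; what remains untyped is only the
IDENTIFICATION, under `Extⁿ_C(X, R U Y) ≅ Extⁿ_D(U X, U Y)`, of `p_*` with the Reynolds average `(1/|N|) Σ_g g·` (Mackey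
`U R ≅ ⊕_g g^*`). Pure `Ext.comp` bookkeeping; no exactness of `U`, `R` and no naturality of `η` is used here. -/

noncomputable section

open CategoryTheory CategoryTheory.Abelian

namespace Summit.Ventures.HSemireg.EquivariantExt

universe w v v' u u'

variable {C : Type u} [Category.{v} C] [Abelian C] {D : Type u'} [Category.{v'} D]
  (U : C ⥤ D) (R : D ⥤ C) [HasExt.{w} C] (η : ∀ Y : C, Y ⟶ R.obj (U.obj Y))

omit [Abelian C] [HasExt C] in
/-- `p := r ≫ η_Y` is idempotent when `η_Y ≫ r = 𝟙`. [folklore] -/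
theorem retraction_comp_unit_idem {Y : C} (r : R.obj (U.obj Y) ⟶ Y) (hr : η Y ≫ r = 𝟙 Y) :
    (r ≫ η Y) ≫ (r ≫ η Y) = r ≫ η Y := by
  rw [Category.assoc, ← Category.assoc (η Y) r, hr, Category.id_comp]

/-- Every class of the form `x ≫ η_Y` is fixed by `· ≫ (r ≫ η_Y)`. [folklore] -/
theorem comp_unit_comp_idem {Y : C} (r : R.obj (U.obj Y) ⟶ Y) (hr : η Y ≫ r = 𝟙 Y) {X : C} {n : ℕ}
    (x : Ext X Y n) :
    (x.comp (Ext.mk₀ (η Y)) (add_zero n)).comp (Ext.mk₀ (r ≫ η Y)) (add_zero n) =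
      x.comp (Ext.mk₀ (η Y)) (add_zero n) := by
  rw [Ext.comp_assoc_of_third_deg_zero, Ext.mk₀_comp_mk₀, ← Category.assoc, hr, Category.id_comp]

/-- A class `z ∈ Extⁿ(X, R(U Y))` fixed by `· ≫ (r ≫ η_Y)` is of the form `x ≫ η_Y`, namely with `x = z ≫ r`.
[folklore] -/
theorem comp_retraction_comp_unit_of_fixed {Y : C} (r : R.obj (U.obj Y) ⟶ Y) {X : C} {n : ℕ}
    (z : Ext X (R.obj (U.obj Y)) n) (hz : z.comp (Ext.mk₀ (r ≫ η Y)) (add_zero n) = z) :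
    (z.comp (Ext.mk₀ r) (add_zero n)).comp (Ext.mk₀ (η Y)) (add_zero n) = z := by
  rw [Ext.comp_assoc_of_third_deg_zero, Ext.mk₀_comp_mk₀, hz]

/-- **Image = fixed part of the idempotent (T-8 (b), image half, abstract form).** With a retraction `r` of `η_Y`,
the image of `Extⁿ_C(X, Y) → Extⁿ_C(X, R(U Y))`, `x ↦ x ≫ η_Y`, is the set of classes fixed by `· ≫ (r ≫ η_Y)`.
In the cell's reading (`R U ≅ ⊕_g g^*`, `r` = averaging) this is «`Ext_α(E,E)` = the `N`-invariants of
`Ext_{A″}(F″,F″)`» up to the naming of `p_*` as the Reynolds operator, which is NOT typed here.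
[cite: BuchweitzFlenner2003, §5; Pridham2024, Rem. 2.26] -/
theorem range_comp_unit_eq_fixed {Y : C} (r : R.obj (U.obj Y) ⟶ Y) (hr : η Y ≫ r = 𝟙 Y) (X : C) (n : ℕ) :
    Set.range (fun x : Ext X Y n => x.comp (Ext.mk₀ (η Y)) (add_zero n)) =
      {z : Ext X (R.obj (U.obj Y)) n | z.comp (Ext.mk₀ (r ≫ η Y)) (add_zero n) = z} := by
  ext z
  constructor
  · rintro ⟨x, rfl⟩
    exact comp_unit_comp_idem U R η r hr x
  · intro hz
    exact ⟨z.comp (Ext.mk₀ r) (add_zero n), comp_retraction_comp_unit_of_fixed U R η r z hz⟩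

end Summit.Ventures.HSemireg.EquivariantExt

end
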